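/-
Copyright: statement-level skeleton of a published paper (lit-balaban cell, Phase-2 proof seat p25, gen 14). No proof
claims beyond what the kernel checks below.
-/
import Literature.MathematicalPhysics.QuantumFieldTheory.BalabanImbrieJaffe1984to88.BIJ88WickDerivatives305

/-!
# `BalabanImbrieJaffe1984to88.BIJ88IbpLeibniz312` — T. Bałaban, J. Imbrie, A. Jaffe, *Effective action and cluster
properties of the abelian Higgs model*, Commun. Math. Phys. **114** (1988) 257–315 [BalabanImbrieJaffe1988], §5.14
p. 311 [PDF 55]: *"those fields can be contracted via covariances … to other observables, to χ′_{Λ^{(k)}}, or to the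
interaction. … A connected component of X is called complete if a contraction to χ′_{Λ^{(k)}} occurs, …, if at least
m̄ + 1 interactions have been differentiated down"* — **WHICH LEGS HIT THE CUTOFFS AND WHICH HIT THE INTERACTION**: the
Leibniz rule for the iterated directional derivatives `dset D` of `BIJ88WickDerivatives305` applied to a product smooth
factor `H = χ·E` (cutoffs `χ` times interaction factor `E`, the shape of (5.14.1)'s weight), so that every term of the
all-orders integration by parts (`wick_smooth`) with its set `D` of legs contracted into `H` splits further by the subset
`D₁ ⊆ D` of legs contracted into the cutoffs (print's *"contraction to χ′"*, count `n_χ′ = |D₁|`) and the complement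
`D∖D₁` contracted into the interaction (print's *"interactions differentiated down"*, count `n_V = |D∖D₁|`) — the two
counts of p25 gen 13's `BIJ88ObservableExtraction312.IbpComponent`.

statement-level skeleton of published theorems with citation tags; proofs where landed; nothing here is a claim
about the Yang–Mills mass gap

PDF held: `paper:balaban1988-cmp114-bij-abelian-higgs-effective-action` (journal page = PDF page + 256); p. 311 = PDF 55
(`p0055.txt` L33–L41).

CITATION HEADER (lean-in-tree rule).  lit-balaban cell, Phase 2, seat p25 gen 14; row **C2.Claim@312** of
`HOME/lit-balaban-r16/ROWS-C2-part2.md` (owner r16, referee ref-5); sequel of p323823 `BIJ88WickDerivatives305` (same seat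
and generation), addressing the reading difference (b) of `BIJ88IbpComponents312`'s HONEST SCOPE (*"remainder = contains a
contraction into the smooth factor H (χ′ and interaction together)"*): here the two are separated.

## What is proved (0 `sorry`, standard axioms, no new `Prop` facts, theorems only)

* §1 `dlist_contDiff` / `dset_contDiff` (smoothness is preserved, no bounds needed), `fderiv_apply_add` / `fderiv_apply_mul`
  (sum and product rules for `∂_u`), **`dlist_add`** / **`dset_add`** (linearity), **`dset_mul`** — THE LEIBNIZ RULE
  `(Π_{i∈D}∂_{Cv_i})(G₁G₂) = Σ_{D₁⊆D} (Π_{i∈D₁}∂_{Cv_i})G₁ · (Π_{i∈D∖D₁}∂_{Cv_i})G₂` (strong induction peeling the smallest label,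
  `dset_insert`, `Finset.sum_powerset_insert`).
* §2 `bounds_mul` (the class *"C^∞ with bounded derivatives of every order"* is closed under products —
  `norm_iteratedFDeriv_mul_le`), **`wick_smooth_mul`** — the all-orders integration by parts for a product smooth factor
  `χ·E`: `∫Π_{i∈T}Φ(v_i)·χE dμ = Σ_{D⊆T}(Σ_{σ∈smallParts(T∖D)}Π w_B)·Σ_{D₁⊆D}∫(Π_{i∈D₁}∂_{Cv_i})χ·(Π_{i∈D∖D₁}∂_{Cv_i})E dμ`
  (legs `D₁` contracted *"to χ′"*, legs `D∖D₁` *"to the interaction"*; each product integrable by the order-0 bounds).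
HONEST SCOPE: calculus only; which cutoff/vertex each leg hits inside `χ = Π_b χ_b`, `E = e^{−V}` (a further Leibniz/Faà di
Bruno split) and the SMALL FACTORS print attaches to `χ′` (large-field support) and to a differentiated vertex (coupling
constant) are not here (`BIJ88ObservableExtraction312` keeps them displayed).  NOT summit progress; NOT continuum; NOT Clay.
Imports `BIJ88WickDerivatives305` only; modifies nothing.
-/

noncomputable section

namespace Literature.MathematicalPhysics.QuantumFieldTheory.BalabanImbrieJaffe1984to88.BIJ88IbpLeibniz312

open MeasureTheory Matrix Finset Function
open scoped BigOperators ContDiff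
open Literature.MathematicalPhysics.QuantumFieldTheory.Balaban1983to89
open B2Eq228Conditioning (weight source)
open BIJ88IntegrationByParts305 (integrable_bdd_mul_weight_source)
open BIJ88PairingAllOrders5133 (smallParts)
open BIJ88WickSource305 (cweight)
open BIJ88WickDerivatives305 (dlist dlist_nil dlist_cons dset dset_empty dset_insert contDiff_fderiv_apply_const
  dset_smooth norm_le_of_iteratedFDeriv_zero wick_smooth)

variable {S : Type} [Fintype S]

/-! ## §1  Linearity and the Leibniz rule for the iterated directional derivatives -/

section Calculus

/-- Smoothness is preserved along a list of directional derivatives. [folklore] [cite: GlimmJaffe1987, §9.1 (9.1.28)] -/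
theorem dlist_contDiff : ∀ (L : List (S → ℝ)) {H : (S → ℝ) → ℝ}, ContDiff ℝ ∞ H → ContDiff ℝ ∞ (dlist L H)
  | [], _, h => h
  | u :: L, _, h => dlist_contDiff L (contDiff_fderiv_apply_const h u)

/-- Sum rule for `∂_u`: `∂_u(G + G') = ∂_uG + ∂_uG'`. [folklore] [cite: GlimmJaffe1987, §9.1 (9.1.28)] -/
theorem fderiv_apply_add {G G' : (S → ℝ) → ℝ} (hG : ContDiff ℝ ∞ G) (hG' : ContDiff ℝ ∞ G') (u : S → ℝ) :
    (fun φ => fderiv ℝ (G + G') φ u) = (fun φ => fderiv ℝ G φ u) + fun φ => fderiv ℝ G' φ u := by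
  funext φ
  rw [((hG.differentiable (by simp) φ).hasFDerivAt.add (hG'.differentiable (by simp) φ).hasFDerivAt).fderiv]
  rfl

/-- Product rule for `∂_u`: `∂_u(G₁G₂) = G₁·∂_uG₂ + (∂_uG₁)·G₂`. [folklore] [cite: GlimmJaffe1987, §9.1 (9.1.28)] -/
theorem fderiv_apply_mul {G₁ G₂ : (S → ℝ) → ℝ} (h₁ : ContDiff ℝ ∞ G₁) (h₂ : ContDiff ℝ ∞ G₂) (u : S → ℝ) :
    (fun φ => fderiv ℝ (G₁ * G₂) φ u) = G₁ * (fun φ => fderiv ℝ G₂ φ u) + (fun φ => fderiv ℝ G₁ φ u) * G₂ := by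
  funext φ
  rw [((h₁.differentiable (by simp) φ).hasFDerivAt.mul (h₂.differentiable (by simp) φ).hasFDerivAt).fderiv]
  simp only [FunLike.coe_add, FunLike.coe_smul, Pi.add_apply, Pi.smul_apply, smul_eq_mul, Pi.mul_apply]
  ring

/-- The class is closed under pointwise products (`ContDiff.mul` in `Pi` form). [folklore] [cite: GlimmJaffe1987, §9.1 (9.1.28)] -/
theorem contDiff_pi_mul {G₁ G₂ : (S → ℝ) → ℝ} (h₁ : ContDiff ℝ ∞ G₁) (h₂ : ContDiff ℝ ∞ G₂) :
    ContDiff ℝ ∞ (G₁ * G₂) :=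
  h₁.mul h₂

/-- **Linearity** of the iterated directional derivatives along a list. [folklore] [cite: GlimmJaffe1987, §9.1 (9.1.28)] -/
theorem dlist_add : ∀ (L : List (S → ℝ)) {G G' : (S → ℝ) → ℝ}, ContDiff ℝ ∞ G → ContDiff ℝ ∞ G' →
    dlist L (G + G') = dlist L G + dlist L G'
  | [], _, _, _, _ => rfl
  | u :: L, _, _, hG, hG' => by
    rw [dlist_cons, dlist_cons, dlist_cons, fderiv_apply_add hG hG' u]
    exact dlist_add L (contDiff_fderiv_apply_const hG u) (contDiff_fderiv_apply_const hG' u)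

variable [DecidableEq S] {κ : Type} [LinearOrder κ]

/-- Smoothness is preserved by `dset D`. [folklore] [cite: GlimmJaffe1987, §9.1 (9.1.28)] -/
theorem dset_contDiff (A : Matrix S S ℝ) (v : κ → S → ℝ) (D : Finset κ) {H : (S → ℝ) → ℝ} (hH : ContDiff ℝ ∞ H) :
    ContDiff ℝ ∞ (dset A v D H) :=
  dlist_contDiff _ hH

/-- **Linearity** of `dset D`. [folklore] [cite: GlimmJaffe1987, §9.1 (9.1.28)] -/
theorem dset_add (A : Matrix S S ℝ) (v : κ → S → ℝ) (D : Finset κ) {G G' : (S → ℝ) → ℝ} (hG : ContDiff ℝ ∞ G)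
    (hG' : ContDiff ℝ ∞ G') : dset A v D (G + G') = dset A v D G + dset A v D G' :=
  dlist_add _ hG hG'

/-- **THE LEIBNIZ RULE** for the legs contracted into a product smooth factor: `(Π_{i∈D}∂_{Cv_i})(G₁G₂) =
Σ_{D₁⊆D} (Π_{i∈D₁}∂_{Cv_i})G₁ · (Π_{i∈D∖D₁}∂_{Cv_i})G₂` — which legs hit `G₁` (the cutoffs: *"a contraction to χ′"*) and
which hit `G₂` (the interaction: *"interactions differentiated down"*).
[cite: BalabanImbrieJaffe1988, §5.14 p.311] [cite: GlimmJaffe1987, §9.1 (9.1.28)] -/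
theorem dset_mul (A : Matrix S S ℝ) (v : κ → S → ℝ) (D : Finset κ) {G₁ G₂ : (S → ℝ) → ℝ} (h₁ : ContDiff ℝ ∞ G₁)
    (h₂ : ContDiff ℝ ∞ G₂) :
    dset A v D (G₁ * G₂) = ∑ D₁ ∈ D.powerset, dset A v D₁ G₁ * dset A v (D \ D₁) G₂ := by
  induction D using Finset.strongInduction generalizing G₁ G₂ with
  | H D ih =>
    rcases D.eq_empty_or_nonempty with hD | hne
    · subst hD
      simp
    · have ha : D.min' hne ∈ D := min'_mem D hne
      set a := D.min' hne with ha_def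
      set t := D.erase a with ht_def
      have hat : a ∉ t := notMem_erase a D
      have hDt : insert a t = D := insert_erase ha
      have hlt : ∀ x ∈ t, a < x := fun x hx =>
        lt_of_le_of_ne (ha_def ▸ min'_le D x (mem_of_mem_erase hx)) (ne_of_mem_erase hx).symm
      have htD : t ⊂ D := erase_ssubset ha
      have h₁' := contDiff_fderiv_apply_const h₁ (A⁻¹ *ᵥ v a)
      have h₂' := contDiff_fderiv_apply_const h₂ (A⁻¹ *ᵥ v a)
      rw [← hDt, dset_insert A v hlt, fderiv_apply_mul h₁ h₂ (A⁻¹ *ᵥ v a),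
        dset_add A v t (contDiff_pi_mul h₁ h₂') (contDiff_pi_mul h₁' h₂), ih t htD h₁ h₂', ih t htD h₁' h₂,
        Finset.sum_powerset_insert hat]
      congr 1
      · refine sum_congr rfl fun D₁ hD₁ => ?_
        have hD₁t : D₁ ⊆ t := mem_powerset.1 hD₁
        have haD₁ : a ∉ D₁ := fun h => hat (hD₁t h)
        rw [insert_sdiff_of_notMem t haD₁, dset_insert A v (fun x hx => hlt x (mem_sdiff.1 hx).1)]
      · refine sum_congr rfl fun D₁ hD₁ => ?_
        have hD₁t : D₁ ⊆ t := mem_powerset.1 hD₁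
        rw [insert_sdiff_insert, sdiff_insert_of_notMem hat, dset_insert A v (fun x hx => hlt x (hD₁t hx))]

end Calculus

/-! ## §2  The all-orders integration by parts for a product smooth factor `χ·E` -/

section Product

variable {H G₁ G₂ : (S → ℝ) → ℝ}

/-- **Products stay in the class** *"C^∞ with bounded derivatives of every order"* (Leibniz bound
`‖D^n(G₁G₂)‖ ≤ Σ_i C(n,i)‖D^iG₁‖‖D^{n−i}G₂‖`). [folklore] [cite: GlimmJaffe1987, §9.1 (9.1.28)] -/
theorem bounds_mul (h₁ : ContDiff ℝ ∞ G₁) (hb₁ : ∀ k : ℕ, ∃ K : ℝ, ∀ φ : S → ℝ, ‖iteratedFDeriv ℝ k G₁ φ‖ ≤ K)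
    (h₂ : ContDiff ℝ ∞ G₂) (hb₂ : ∀ k : ℕ, ∃ K : ℝ, ∀ φ : S → ℝ, ‖iteratedFDeriv ℝ k G₂ φ‖ ≤ K) (n : ℕ) :
    ∃ K : ℝ, ∀ φ : S → ℝ, ‖iteratedFDeriv ℝ n (G₁ * G₂) φ‖ ≤ K := by
  choose K₁ hK₁ using hb₁
  choose K₂ hK₂ using hb₂
  refine ⟨∑ i ∈ Finset.range (n + 1), (n.choose i : ℝ) * K₁ i * K₂ (n - i), fun φ => ?_⟩
  have hn : (n : WithTop ℕ∞) ≤ ∞ := by exact_mod_cast le_top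
  refine (norm_iteratedFDeriv_mul_le h₁ h₂ φ hn).trans (sum_le_sum fun i _ => ?_)
  have h0 : 0 ≤ K₁ i := (norm_nonneg _).trans (hK₁ i φ)
  exact mul_le_mul (mul_le_mul_of_nonneg_left (hK₁ i φ) (Nat.cast_nonneg _)) (hK₂ (n - i) φ) (norm_nonneg _)
    (mul_nonneg (Nat.cast_nonneg _) h0)

variable [DecidableEq S] {κ : Type} [LinearOrder κ]

/-- Each Leibniz term `(Π_{i∈D₁}∂_{Cv_i})G₁ · (Π_{i∈D₂}∂_{Cv_i})G₂` times the Gaussian density is integrable (both factors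
are bounded continuous). [folklore] [cite: GlimmJaffe1987, §9.1 (9.1.28)] -/
theorem integrable_dset_mul {A : Matrix S S ℝ} (hA : A.PosDef) (f : S → ℝ) (v : κ → S → ℝ) (D₁ D₂ : Finset κ)
    (h₁ : ContDiff ℝ ∞ G₁) (hb₁ : ∀ k : ℕ, ∃ K : ℝ, ∀ φ : S → ℝ, ‖iteratedFDeriv ℝ k G₁ φ‖ ≤ K)
    (h₂ : ContDiff ℝ ∞ G₂) (hb₂ : ∀ k : ℕ, ∃ K : ℝ, ∀ φ : S → ℝ, ‖iteratedFDeriv ℝ k G₂ φ‖ ≤ K) :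
    Integrable fun φ : S → ℝ => dset A v D₁ G₁ φ * dset A v D₂ G₂ φ * (weight A φ * source f φ) := by
  obtain ⟨hc₁, hb₁'⟩ := dset_smooth A v D₁ h₁ hb₁
  obtain ⟨hc₂, hb₂'⟩ := dset_smooth A v D₂ h₂ hb₂
  obtain ⟨K₁, hK₁⟩ := hb₁' 0
  obtain ⟨K₂, hK₂⟩ := hb₂' 0
  have hK : ∀ φ : S → ℝ, ‖dset A v D₁ G₁ φ * dset A v D₂ G₂ φ‖ ≤ K₁ * K₂ := fun φ => by
    rw [norm_mul]
    have e₁ := norm_le_of_iteratedFDeriv_zero hK₁ φ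
    have e₂ := norm_le_of_iteratedFDeriv_zero hK₂ φ
    have h0 : 0 ≤ K₁ := (norm_nonneg _).trans e₁
    exact mul_le_mul e₁ e₂ (norm_nonneg _) h0
  exact integrable_bdd_mul_weight_source hA f ((hc₁.continuous.mul hc₂.continuous).aestronglyMeasurable) hK

/-- **THE ALL-ORDERS INTEGRATION BY PARTS FOR A PRODUCT SMOOTH FACTOR `χ·E`** (cutoffs times interaction, the shape of
(5.14.1)'s weight): `∫Π_{i∈T}Φ(v_i)·χE dμ = Σ_{D⊆T}(Σ_{σ∈smallParts(T∖D)}Π_{B∈σ}w_B)·Σ_{D₁⊆D}∫(Π_{i∈D₁}∂_{Cv_i})χ·(Π_{i∈D∖D₁}∂_{Cv_i})E dμ`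
— the legs `D₁` are *"contracted to χ′"* and the legs `D∖D₁` *"to the interaction"* (p. 311), the rest pair among
themselves or go to ℱ. [cite: BalabanImbrieJaffe1988, §5.14 p.311] [cite: GlimmJaffe1987, §9.1 (9.1.28), (9.1.32)] -/
theorem wick_smooth_mul (A : Matrix S S ℝ) (hA : A.PosDef) (f : S → ℝ) (v : κ → S → ℝ) (T : Finset κ)
    {χ E : (S → ℝ) → ℝ} (hχ : ContDiff ℝ ∞ χ) (hbχ : ∀ k : ℕ, ∃ K : ℝ, ∀ φ : S → ℝ, ‖iteratedFDeriv ℝ k χ φ‖ ≤ K)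
    (hE : ContDiff ℝ ∞ E) (hbE : ∀ k : ℕ, ∃ K : ℝ, ∀ φ : S → ℝ, ‖iteratedFDeriv ℝ k E φ‖ ≤ K) :
    ∫ φ : S → ℝ, (∏ i ∈ T, φ ⬝ᵥ v i) * (χ φ * E φ) * (weight A φ * source f φ)
      = ∑ D ∈ T.powerset, (∑ σ ∈ smallParts (T \ D), ∏ B ∈ σ, cweight A f v B) *
          ∑ D₁ ∈ D.powerset,
            ∫ φ : S → ℝ, dset A v D₁ χ φ * dset A v (D \ D₁) E φ * (weight A φ * source f φ) := by
  have hH : ContDiff ℝ ∞ (χ * E) := contDiff_pi_mul hχ hE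
  have hb := bounds_mul hχ hbχ hE hbE
  have e : (fun φ : S → ℝ => (∏ i ∈ T, φ ⬝ᵥ v i) * (χ φ * E φ) * (weight A φ * source f φ))
      = fun φ => (∏ i ∈ T, φ ⬝ᵥ v i) * (χ * E) φ * (weight A φ * source f φ) := by
    funext φ
    rfl
  rw [show (∫ φ : S → ℝ, (∏ i ∈ T, φ ⬝ᵥ v i) * (χ φ * E φ) * (weight A φ * source f φ))
      = ∫ φ : S → ℝ, (∏ i ∈ T, φ ⬝ᵥ v i) * (χ * E) φ * (weight A φ * source f φ) by rw [e],
    wick_smooth A hA f v T hH hb]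
  refine sum_congr rfl fun D _ => ?_
  congr 1
  rw [dset_mul A v D hχ hE, ← integral_finsetSum _ fun D₁ _ => integrable_dset_mul hA f v D₁ (D \ D₁) hχ hbχ hE hbE]
  refine integral_congr_ae (Filter.Eventually.of_forall fun φ => ?_)
  simp only [Finset.sum_apply, Pi.mul_apply, Finset.sum_mul]

end Product

end Literature.MathematicalPhysics.QuantumFieldTheory.BalabanImbrieJaffe1984to88.BIJ88IbpLeibniz312
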